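import Summits.QuantumFields.BalabanUV.T4Continuum.Spine.NE1p.DressedTowerWitnessSliceEnd
import Summits.QuantumFields.BalabanUV.T4Continuum.Spine.NE1p.DressedAbsorptionWitness

/-!
# T⁴ programme, spine estimate NE1′ (node O3b/H2) — TWO LIVE FAMILIES IN ONE MET COMPONENT WITH GENUINE ABSORPTION AT AN
# INTEGER BLOCKING FACTOR: a decided function-level toy for the CANONICAL TERMINAL FACE, part 1 of 3 — the datum, the shared
# observable exponent and the step law (formalisation crew `b2b-balaban-t4-ne1p-formalise-*`, leaf seat 04, generation 3; witness
# row W13 of `t4/formal/NE1p/LEAVES.md`, INTENT HOME/CLAIMS.log l.11538, BOOKED typer R-T59 (v) l.11573; NOT a crew estimate row)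

Cell `pub-balaban`, sub-cell `t4`, BINDER-OWNERS row NE1′ (owner lineage t4-ne1p-p1; root `Spine/NE1p/DressedRoot.lean` p211416).
ADDITIVE — imports leaf-03's `Spine/NE1p/DressedTowerWitnessSliceEnd` (W7 part 2, p214558: the generic two-atom calculus `flAt`∕
`ae_flAt`∕`integral_flAt`∕`mem_bddClass_flAt`∕`aesm_flAt`, `zeroExp`, `realBaseAt_W`, `exponentSliceAt_M` BY NAME, and through it
this lineage's `WindowScheduleModWin.geometric`, row S1e part 2 p213785) and leaf-02's `Spine/NE1p/DressedAbsorptionWitness` (W3,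
p213076: the two-family birth-scale dictionary `bs`∕`bs_le`∕`bs_false`∕`bs_true` BY NAME) ONLY; modifies nothing.  Part 2 =
`Spine/NE1p/DressedTowerWitnessPairBinders.lean` (the schedule-facing binders: births at BOTH scales, the (I4′) links, the fresh
pairs for every live generation, the booking convention `hne`∕`hsup`); part 3 = `Spine/NE1p/DressedTowerWitnessPairEnd.lean`
(anchoring, absorption with `A = ⅛`, and the canonical terminal face S3l `dressedStability_of_canonicalSliceWinSchedules` p215128
APPLIED BY NAME).

WHY.  Every function-level toy of the crew so far (W5∕W7∕W9∕W10∕W12 on `towerW`∕`towerM`, W11 as announced) books ONE family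
born at scale `0`, whose met component's observable exponent carries that family's own generations only (`Sg k b = {(b,0)}`),
with the history-free absorption door (`Sabs ≡ ∅`, `A = 0`); W8 has two families and genuine absorption at BOOKING level only.
Three displayed binder corners of the terminal face therefore have no non-trivial function-level inhabitant: (i) the H2
CROSS-FAMILY dictionary — `hQ`∕`hSg`∕`hδf`∕`hδfwk`∕`hpairx` with `Sg k b ∋ (b′, j′)`, `b′ ≠ b` (row S1e's per-step cross-family
margins); (ii) a birth at a POSITIVE scale through the scheduled birth window (`hsl` at `k′ = birthScale b = 1`); (iii) the
absorption DATA `holder`∕`hsub`∕`habs`∕`hβ` with `A > 0` jointly with function-level families.  This part builds the datum: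
* §1 the INTEGER blocking factor `L = 128` (any integer `≥ 123` passes `locCell` with the tree's `exp_three_lt`; `128 = 2⁷` for
  round arithmetic — a toy choice, NOT «Bałaban's L», caveat k2), `ψ = 128⁻²`, `τ = 128⁻³`, and ONE cutoff-free schedule
  `Wp := WindowScheduleModWin.geometric 1 1 ψ (ψ∕4) 1 0` (ratio `2σ k = ½·ϱc k`: `κ = ½`);
* §2 the booking `BP K` — TWO families `Bool` (old `false` born at `0`, young `true` born at `bs K true = min 1 K`), ONE cube per
  scale housing both, sizes `amp_b·ψ^{k+1}∕2`; the trajectory `TP K` with birth generations `gP K b = ¼τ^{K−j_b}` PLUS, for the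
  young family when it is genuinely younger, the ABSORBED mass `A·ρ₀·gP K false` (`A = ⅛`, `ρ₀ = ψ·alphaCell ½`) — the
  AbsorbLaw-type equality part 2 proves; the tower `towerP`;
* §3 the function-level data: family `b` is carried on ITS OWN bond coordinate `crd b ∈ {0,1}` of the site `0` as the affine
  functional `amp K b·(U 0 (crd b) + shift k − shift j_b)`; BOTH born families are LIVE in the shared component's observable
  exponent `𝒬P K k U z := c·Σ_{(f,j) ∈ SgP K k} (FnP K f j k (U+z) − FnP K f j k (U+0))`, `c = ⅛` (the H2 dictionary `hQ` IS the
  definition; the coupling `xP K k` JUMPS when the young family is born); the two-atom laws `flAt (atomP (k+1))` make the dressed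
  operation a weighted two-point average (`wOp_pair`) and `hFn` holds AS AN EQUATION for both families with ONE shift sequence
  (`FnP_succ`); `rel := Eq`; ACTION exponent `𝒜 ≡ 0`, regeneration `creg ≡ 0`, margins `s ≡ 0` — DECLARED ≡ 0 (W9∕W10∕W12 carry
  those families live);
* (part 2) the schedule-facing binders; (part 3) anchoring ∕ absorption ∕ the face.

WHAT IT IS NOT.  Not an estimate; nothing of Bałaban's densities, D-terms, windows or of [Balaban1989LargeFieldII] (1.69)∕(1.79)
absorption is encoded (CONTEXT only); no `def … : Prop`; every declaration is [folklore] toy kernel mathematics ([decided toy]), 0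
sorry, 0 citations.  VALUE (with parts 2–3) = a joint-satisfiability certificate of the terminal face's binder SHAPES with the
cross-family dictionary, a positive birth scale and `A > 0` live — non-vacuity of SHAPES only; it changes nothing about the walls.
CREDIT: the integer-L sizing notes of leaf-09-g3 (LF-4, l.11316), leaf-02-g4 (l.11450) and leaf-07-g5 (l.11470) fixed the
arithmetic frame; W7 (leaf-03) is the one-family template this datum doubles; W8 (leaf-02) the anchoring ∕ absorption template.

HONEST FRAMING.  Rung (B)+1 bookkeeping on ONE finite four-torus of fixed physical size — NOT infinite volume, NOT a mass gap, NOT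
OS on ℝ⁴, NOT the Clay problem, NOT summit progress.  NE1′ is NOT PRINTED and NOT PROVED; every headline reads «NE1′ ⇐ the named
binders»; spine PROVED 0∕9 unchanged.  HONEST DEPENDENCY: continuum YM on T⁴ ⇐ BetaPertH ∧ nine spine estimates (0/9 proved);
BetaPertH ⇐ (D1) ∧ (D4) ∧ CAP+tail; G-an2-4 gates asym, D1 and NE2/3/4.
-/

noncomputable section

namespace Summit.QuantumFields.BalabanUV.T4Continuum.NE1p.DressedTowerWitnessPair

open MeasureTheory Set Metric Filter Finset
open scoped BigOperators
open Literature.MathematicalPhysics.QuantumFieldTheory.Balaban1983to89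
open Literature.MathematicalPhysics.QuantumFieldTheory.Balaban1983to89.T4TermFormat
open Literature.MathematicalPhysics.QuantumFieldTheory.Balaban1983to89.T4TermFormat.Booking
open Literature.MathematicalPhysics.QuantumFieldTheory.Balaban1983to89.T4GatedBooking
open Literature.MathematicalPhysics.QuantumFieldTheory.Balaban1983to89.T4TrajectoryComparison
open T4TrajectoryModulus (bondBall bondBall_add_mem bondBall_latMove_add_mem bondBall_diam)
open T4BlockTransport (Fld NDir latMove latN Site norm_dir_le)
open T4BirthChartTransport (GaugeInvariant BirthSlice RelGauge)
open T4TrajectoryDensity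
open Summit.QuantumFields.BalabanUV.T4Continuum.T4TrajectoryDensityDressed
open Summit.QuantumFields.BalabanUV.T4Continuum.T4TrajectoryDensityWitness
open Summit.QuantumFields.BalabanUV.T4Continuum.NE1p.DressedRoot
open Summit.QuantumFields.BalabanUV.T4Continuum.NE1p.DressedUniformConstants
open Summit.QuantumFields.BalabanUV.T4Continuum.NE1p.DressedWindowScheduleWin
open Summit.QuantumFields.BalabanUV.T4Continuum.NE1p.DressedWindowScheduleModWin
open Summit.QuantumFields.BalabanUV.T4Continuum.NE1p.DressedTowerWitness
open Summit.QuantumFields.BalabanUV.T4Continuum.NE1p.DressedAbsorptionWitness (bs bs_le bs_false bs_true)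

/-! ## §1 The integer blocking factor `L = 128`, `ψ = 128⁻²`, ONE cutoff-free schedule [decided toy] -/

/-- `ψ = 128⁻² > 0`. [arith] [folklore] -/ theorem psiP_pos : 0 < ((128 : ℝ) ^ 2)⁻¹ := by positivity
/-- `ψ < 1`. [arith] [folklore] -/ theorem psiP_lt_one : ((128 : ℝ) ^ 2)⁻¹ < 1 := by norm_num
/-- `ψ ≤ 1`. [arith] [folklore] -/ theorem psiP_le_one : ((128 : ℝ) ^ 2)⁻¹ ≤ 1 := psiP_lt_one.le
/-- `ψ^k ≤ 1`. [arith] [folklore] -/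
theorem psiP_pow_le_one (k : ℕ) : (((128 : ℝ) ^ 2)⁻¹) ^ k ≤ 1 := pow_le_one₀ psiP_pos.le psiP_le_one
/-- `τ = 128⁻³ > 0`. [arith] [folklore] -/ theorem tauP_pos : 0 < ((128 : ℝ)⁻¹ ^ 3) := by positivity

/-- **THE LOCATED LARGENESS AT THE INTEGER `L = 128`** [decided toy]: `locCell 128 2 0 ½ = 3e³∕128 ≤ ½` (from the tree's
`exp_three_lt : e³ < 20.5`; any integer `L ≥ 123` would pass — `128` is a toy choice, NOT Bałaban's `L`). [folklore] -/
theorem hlocP : locCell 128 (4 * (1 / 2) / 1) 0 (1 / 2) ≤ 1 / 2 := by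
  unfold locCell alphaCell
  have h := exp_three_lt
  nlinarith [Real.exp_pos 3]

/-- **THE ONE CUTOFF-FREE SCHEDULE** [decided toy]: this lineage's `WindowScheduleModWin.geometric` with ratio `ψ`, fluctuation
scale `ψ∕4`, chart radius scale `1`, final window `0`: `σ k = ψ^{k+1}∕4`, `wc k = ψ^{k+1}∕2`, `ϱc k = ψ^{k+1}`, windows
`bondBall (c_P ψ^k)`. [folklore] -/
def Wp : WindowScheduleModWin 1 1 :=
  WindowScheduleModWin.geometric 1 1 (((128 : ℝ) ^ 2)⁻¹) (((128 : ℝ) ^ 2)⁻¹ / 4) 1 0 psiP_pos psiP_lt_one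
    (by have := psiP_pos; positivity) (by have := psiP_le_one; linarith) one_pos le_rfl

/-- The window constant `c_P = ((1+2ψ)·ψ∕4 + 1)∕(1−ψ)`. [folklore] -/
def cP : ℝ := ((1 + 2 * ((128 : ℝ) ^ 2)⁻¹) * (((128 : ℝ) ^ 2)⁻¹ / 4) + 1) / (1 - ((128 : ℝ) ^ 2)⁻¹)

/-- [arith] [folklore] -/
theorem cP_pos : 0 < cP := by
  unfold cP
  have h1 : (0 : ℝ) < 1 - ((128 : ℝ) ^ 2)⁻¹ := by norm_num
  have := psiP_pos
  positivity

/-- [arith] [folklore] The windows of `Wp`: `ρw k = c_P·ψ^k`. -/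
theorem Wp_ρw (k : ℕ) : Wp.ρw k = cP * (((128 : ℝ) ^ 2)⁻¹) ^ k := by
  show 0 + ((1 + 2 * ((128 : ℝ) ^ 2)⁻¹) * (((128 : ℝ) ^ 2)⁻¹ / 4) + 1) / (1 - ((128 : ℝ) ^ 2)⁻¹) *
    (((128 : ℝ) ^ 2)⁻¹) ^ k = _
  rw [zero_add]; rfl

/-- [arith] [folklore] -/ theorem Wp_σ (k : ℕ) : Wp.σ k = ((128 : ℝ) ^ 2)⁻¹ / 4 * (((128 : ℝ) ^ 2)⁻¹) ^ k := rfl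
/-- [arith] [folklore] -/ theorem Wp_wc (k : ℕ) : Wp.wc k = 2 * (((128 : ℝ) ^ 2)⁻¹ / 4) * (((128 : ℝ) ^ 2)⁻¹) ^ k := rfl
/-- [arith] [folklore] -/ theorem Wp_ϱc (k : ℕ) : Wp.ϱc k = 1 * (((128 : ℝ) ^ 2)⁻¹) ^ (k + 1) := rfl

/-- [arith] [folklore] Windows are nonnegative. -/
theorem Wp_ρw_nonneg (k : ℕ) : 0 ≤ Wp.ρw k := by rw [Wp_ρw]; have := cP_pos; have := psiP_pos; positivity

/-- [folklore] The zero background lies in every window. -/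
theorem zero_mem_windowP (k : ℕ) : (0 : Fld 4 ℂ) ∈ (bondBall 4 (Wp.ρw k) : Set (Fld 4 ℂ)) :=
  fun x ν => by rw [Pi.zero_apply, Pi.zero_apply, norm_zero]; exact Wp_ρw_nonneg k

/-- **THE SCHEDULE's K-FREE RATIO** `2σ k = ½·ϱc k` (`κ = ½`). [folklore] -/
theorem hratioP : ∀ k, 2 * Wp.σ k ≤ 1 / 2 * Wp.ϱc k := fun k => by
  rw [Wp_σ, Wp_ϱc, pow_succ]; exact le_of_eq (by ring)

/-! ## §2 The datum at cutoff `K`: two families, one cube per scale, genuine absorption [decided toy] -/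

/-- The transverse defect of step `k`: `δ_k = ψ^k∕2` (used at `k+1`). [folklore] -/
def defP (k : ℕ) : ℝ := 1 / 2 * (((128 : ℝ) ^ 2)⁻¹) ^ k

/-- The fresh defect ∕ second atom of step `k`: `ψ^{k+1}∕4`. [folklore] -/
def dfP (k : ℕ) : ℝ := (((128 : ℝ) ^ 2)⁻¹) ^ (k + 1) / 4

/-- [arith] [folklore] -/ theorem defP_pos (k : ℕ) : 0 < defP k := by unfold defP; have := psiP_pos; positivity
/-- [arith] [folklore] -/ theorem dfP_pos (k : ℕ) : 0 < dfP k := by unfold dfP; have := psiP_pos; positivity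

/-- The cell's transport rate `ρ₀ = ψ·alphaCell ½ = 3e³∕128²`. [folklore] -/
def rhoP : ℝ := ((128 : ℝ) ^ 2)⁻¹ * alphaCell (1 / 2)

/-- [arith] [folklore] -/ theorem rhoP_pos : 0 < rhoP := mul_pos psiP_pos (alphaCell_pos (by norm_num))

/-- BIRTH GENERATIONS [decided toy]: `¼τ^{K−j_b}` (the dressing, `C·¼ = β₀ = ½`) plus, for the young family when it is genuinely
younger (`K ≥ 1`), the ABSORBED mass `A·ρ₀·gP K false`, `A = ⅛` — `A ×` the old family's transported envelope at scale `1`. [folklore] -/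
def gP (K : ℕ) (b : Bool) : ℝ :=
  1 / 4 * ((128 : ℝ)⁻¹ ^ 3) ^ (K - bs K b) +
    if b = true ∧ 1 ≤ K then 1 / 8 * rhoP * (1 / 4 * ((128 : ℝ)⁻¹ ^ 3) ^ K) else 0

/-- Birth generations are positive. [folklore] -/
theorem gP_pos (K : ℕ) (b : Bool) : 0 < gP K b := by
  unfold gP
  have h1 : 0 < 1 / 4 * ((128 : ℝ)⁻¹ ^ 3) ^ (K - bs K b) := by positivity
  have h2 : 0 ≤ (if b = true ∧ 1 ≤ K then 1 / 8 * rhoP * (1 / 4 * ((128 : ℝ)⁻¹ ^ 3) ^ K) else 0) := by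
    split_ifs
    · have := rhoP_pos; positivity
    · exact le_rfl
  linarith

/-- The AMPLITUDE of family `b`'s carried functional: its birth generation over the birth slice bound `c_P ψ^{j_b} + 3`. [folklore] -/
def amp (K : ℕ) (b : Bool) : ℝ := gP K b / (cP * (((128 : ℝ) ^ 2)⁻¹) ^ bs K b + 3)

/-- [arith] [folklore] -/
theorem birthBound_pos (K : ℕ) (b : Bool) : 0 < cP * (((128 : ℝ) ^ 2)⁻¹) ^ bs K b + 3 := by
  have := cP_pos; have := psiP_pos; positivity

/-- Amplitudes are positive. [folklore] -/
theorem amp_pos (K : ℕ) (b : Bool) : 0 < amp K b := div_pos (gP_pos K b) (birthBound_pos K b)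

/-- [arith] [folklore] `amp·(c_P ψ^{j_b} + 3) = gP`. -/
theorem amp_mul_birthBound (K : ℕ) (b : Bool) : amp K b * (cP * (((128 : ℝ) ^ 2)⁻¹) ^ bs K b + 3) = gP K b :=
  div_mul_cancel₀ _ (birthBound_pos K b).ne'

/-- TOY BOOKING at cutoff `K` [decided toy]: two families (`Bool`), one cube per scale `0…K`, every family felt at every cube from
its birth on, POSITIVE booked size `amp K b·ψ^{k+1}∕2` at scale `k`.  Nothing of Bałaban's is modelled. [folklore] -/
def BP (K : ℕ) : T4TermFormat.Booking where
  K := K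
  Dom := Bool
  domScale := bs K
  treeLen := fun _ => 0
  treeLen_nonneg := fun _ => le_rfl
  balSize := fun _ => 0
  Birth := Bool
  births := Finset.univ
  mem_births := fun b => Finset.mem_univ b
  birthScale := bs K
  birth_le := bs_le K
  loc := id
  loc_scale := fun _ => rfl
  Cube := Fin (K + 1)
  cubes := Finset.univ
  mem_cubes := fun q => Finset.mem_univ q
  cubeScale := fun q => q.val
  cube_le := fun q => Nat.lt_succ_iff.mp q.isLt
  feltAt := fun q => Finset.univ.filter fun b => bs K b ≤ q.val
  felt_birth_le := fun _ _ hb => (Finset.mem_filter.mp hb).2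
  size := fun b k => amp K b * defP (k + 1)
  size_nonneg := fun b k => (mul_pos (amp_pos K b) (defP_pos (k + 1))).le
  pair := fun _ _ _ => 0

/-- TOY TRAJECTORY [decided toy]: one generation per family (its birth, size `gP K b`), re-linearised size `amp K b·ψ^{k+1}∕2` =
the booked size. [folklore] -/
def TP (K : ℕ) : Trajectory (BP K) where
  lin := fun b k' k => if k' = bs K b then amp K b * defP (k + 1) else 0
  lin_nonneg := fun b k' k => by have := amp_pos K b; have := defP_pos (k + 1); split_ifs <;> positivity
  gen := fun b k' => if k' = bs K b then gP K b else 0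
  gen_nonneg := fun b k' => by have := gP_pos K b; split_ifs <;> positivity
  size_le := fun b k hbk _ => by
    show amp K b * defP (k + 1) ≤ ∑ k' ∈ Icc (bs K b) k, (if k' = bs K b then amp K b * defP (k + 1) else 0)
    rw [Finset.sum_ite_eq' (Icc (bs K b) k) (bs K b) (fun _ => amp K b * defP (k + 1))]
    have hbk' : bs K b ≤ k := hbk
    rw [if_pos (Finset.mem_Icc.mpr ⟨le_rfl, hbk'⟩)]

/-- TOY TOWER [decided toy]: the two-family datum at every cutoff (one run parameter). [folklore] -/
def towerP : DressedTower Unit where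
  B := fun _ K => BP K
  K_eq := fun _ _ => rfl
  T := fun _ K => TP K

/-- LIVE FAMILIES of the met component at step `k` [decided toy]: every family born at a scale `≤ k` (none above the cutoff) —
from scale `1` on BOTH families are live in the SAME component. [folklore] -/
def SP (K : ℕ) (k : ℕ) (_b : Bool) : Finset Bool := Finset.univ.filter fun f => bs K f ≤ k ∧ k ≤ K

/-- LIVE GENERATIONS of the met component at step `k` [decided toy]: the birth generation of every live family —
`{(false,0)} ∪ {(true, j_true)}` once the young family is born: the CROSS-FAMILY index set of the H2 dictionary. [folklore] -/
def SgP (K : ℕ) (k : ℕ) (b : Bool) : Finset (Bool × ℕ) := (SP K k b).image fun f => (f, bs K f)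

/-- [folklore] Membership in the live generations. -/
theorem mem_SgP {K k : ℕ} {b : Bool} {x : Bool × ℕ} : x ∈ SgP K k b ↔ x.1 ∈ SP K k b ∧ x.2 = bs K x.1 := by
  constructor
  · intro hx
    obtain ⟨f, hf, rfl⟩ := Finset.mem_image.mp hx
    exact ⟨hf, rfl⟩
  · rintro ⟨h1, h2⟩
    exact Finset.mem_image.mpr ⟨x.1, h1, by rw [← h2]⟩

/-- [folklore] Sums over the live generations are sums over the live families. -/
theorem sum_SgP {K k : ℕ} {b : Bool} (g : Bool × ℕ → ℂ) :
    ∑ x ∈ SgP K k b, g x = ∑ f ∈ SP K k b, g (f, bs K f) :=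
  Finset.sum_image fun _ _ _ _ h => (Prod.mk.inj h).1

/-! ## §3 The function-level data: own coordinates, one observable exponent for both families [decided toy] -/

/-- The bond coordinate carrying family `b` at the site `0`: old `0`, young `1`. [folklore] -/
def crd (b : Bool) : Fin 4 := if b = true then 1 else 0

/-- Evaluation at family `b`'s bond `⟨0, crd b⟩`. [folklore] -/
def evB (b : Bool) (U : Fld 4 ℂ) : ℂ := U 0 (crd b)

/-- The unit bond field on family `b`'s bond. [folklore] -/
def eB (b : Bool) : Fld 4 ℂ := fun x ν => if x = 0 ∧ ν = crd b then 1 else 0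

/-- [folklore] -/ @[simp] theorem evB_zero (b : Bool) : evB b (0 : Fld 4 ℂ) = 0 := rfl
/-- [folklore] -/ @[simp] theorem evB_add (b : Bool) (U z : Fld 4 ℂ) : evB b (U + z) = evB b U + evB b z := rfl
/-- [folklore] -/ @[simp] theorem evB_smul (b : Bool) (c : ℂ) (U : Fld 4 ℂ) : evB b (c • U) = c * evB b U := rfl
/-- [folklore] -/ @[simp] theorem evB_eB (b : Bool) : evB b (eB b) = 1 := by simp [evB, eB]
/-- The chart moves family `b`'s bond affinely. [folklore] -/
theorem evB_latMove (b : Bool) (U : Fld 4 ℂ) (p : NDir 4 ℂ) (t : ℂ) : evB b (latMove U p t) = evB b U + t * evB b p.1.1 := rfl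
/-- [folklore] -/
theorem norm_eB_le (b : Bool) (x : Site 4) (ν : Fin 4) : ‖eB b x ν‖ ≤ 1 := by
  unfold eB; split_ifs <;> simp
/-- [folklore] The bond value is dominated by the declared direction bound. -/
theorem norm_evB_dir_le (b : Bool) (p : NDir 4 ℂ) : ‖evB b p.1.1‖ ≤ latN p := norm_dir_le p 0 (crd b)

/-- The second atom of step `k`'s law: the constant bond field `ψ^k∕4` (used at `k+1`, inside `bondBall (σ k)`). [folklore] -/
def atomP (k : ℕ) : Fld 4 ℂ := fun _ _ => (((((128 : ℝ) ^ 2)⁻¹) ^ k / 4 : ℝ) : ℂ)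

/-- [folklore] -/
@[simp] theorem evB_atomP (b : Bool) (k : ℕ) : evB b (atomP k) = (((((128 : ℝ) ^ 2)⁻¹) ^ k / 4 : ℝ) : ℂ) := rfl

/-- THE COUPLING of the second atom at step `k` [decided toy]: `x_k = c·(Σ_{live f} amp K f)·ψ^{k+1}∕4`, `c = ⅛` — it JUMPS when the
young family is born. [folklore] -/
def xP (K k : ℕ) : ℝ := 1 / 8 * (∑ f ∈ SP K k false, amp K f) * dfP k

/-- [arith] [folklore] -/
theorem xP_nonneg (K k : ℕ) : 0 ≤ xP K k := by
  unfold xP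
  have h : 0 ≤ ∑ f ∈ SP K k false, amp K f := Finset.sum_nonneg fun f _ => (amp_pos K f).le
  have := dfP_pos k
  positivity

/-- The weight of the second atom: `e^{−x_k} ∈ (0, 1]`. [folklore] -/
def wtP (K k : ℕ) : ℝ := Real.exp (-xP K k)

/-- [arith] [folklore] -/ theorem wtP_pos (K k : ℕ) : 0 < wtP K k := Real.exp_pos _

/-- The accumulated dressing from scale `0`: `shift 0 = 0`, `shift (k+1) = shift k + (ψ^{k+1}∕4)·w_k∕(1 + w_k)`; a family born at
`j` carries `shift k − shift j`. [folklore] -/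
def shiftP (K : ℕ) : ℕ → ℝ
  | 0 => 0
  | k + 1 => shiftP K k + dfP k * (wtP K k / (1 + wtP K k))

/-- THE CARRIED FUNCTIONALS at cutoff `K` [decided toy]: the birth generation `j_f` of family `f` at scale `k` is
`amp K f·(U 0 (crd f) + shift k − shift j_f)`; other generations are absent (`0`). [folklore] -/
def FnP (K : ℕ) (f : Bool) (k' k : ℕ) (U : Fld 4 ℂ) : ℂ :=
  if k' = bs K f then (amp K f : ℂ) * (evB f U + ((shiftP K k - shiftP K (bs K f) : ℝ) : ℂ)) else 0

/-- **THE OBSERVABLE-ATTACHED EXPONENT OF THE SHARED COMPONENT BY THE ASSEMBLY'S DICTIONARY** [decided toy]: `c` times the fresh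
differences of EVERY live generation of EITHER family at the pair `(U+z, U+0)` — the H2 dictionary `hQ` is this definition. [folklore] -/
def 𝒬P (K : ℕ) (k : ℕ) (U z : Fld 4 ℂ) : ℂ :=
  (((1 / 8 : ℝ)) : ℂ) * ∑ x ∈ SgP K k false, (FnP K x.1 x.2 k (U + z) - FnP K x.1 x.2 k (U + 0))

/-- The fresh difference of a live generation is background-FREE: `amp·z 0 (crd f)`. [folklore] -/
theorem FnP_fresh (K : ℕ) (f : Bool) (k : ℕ) (U z : Fld 4 ℂ) :
    FnP K f (bs K f) k (U + z) - FnP K f (bs K f) k (U + 0) = (amp K f : ℂ) * evB f z := by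
  simp only [FnP, ↓reduceIte, evB_add, add_zero]; ring

/-- The exponent vanishes at the reference atom. [folklore] -/
theorem 𝒬P_zero (K k : ℕ) (U : Fld 4 ℂ) : 𝒬P K k U 0 = 0 := by
  unfold 𝒬P; rw [sum_SgP]; simp

/-- The exponent at the second atom is the coupling `x_k`. [folklore] -/
theorem 𝒬P_atom (K k : ℕ) (U : Fld 4 ℂ) : 𝒬P K k U (atomP (k + 1)) = ((xP K k : ℝ) : ℂ) := by
  unfold 𝒬P xP dfP
  rw [sum_SgP]
  simp only [FnP_fresh, evB_atomP]
  rw [← Finset.sum_mul]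
  push_cast
  ring

/-- The weight at the reference atom `0` is `1`. [folklore] -/
theorem expWeight_P_zero (K k : ℕ) (U : Fld 4 ℂ) : expWeight base₁ (zeroExp + 𝒬P K k) U 0 = 1 := by
  rw [expWeight_apply]; simp [base₁, zeroExp, 𝒬P_zero]

/-- The weight at the second atom is `e^{−x_k}`. [folklore] -/
theorem expWeight_P_atom (K k : ℕ) (U : Fld 4 ℂ) :
    expWeight base₁ (zeroExp + 𝒬P K k) U (atomP (k + 1)) = (wtP K k : ℂ) := by
  rw [expWeight_apply]
  simp only [base₁, zeroExp, Pi.add_apply, 𝒬P_atom, zero_add, Complex.ofReal_one, one_mul, wtP, Complex.ofReal_exp]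
  push_cast; ring_nf

/-- **THE DRESSED OPERATION IN CLOSED FORM — A WEIGHTED TWO-POINT AVERAGE** [folklore]: with both live families in the exponent,
`wOp … U h = (h 0 + e^{−x_k}·h z_k)∕(1 + e^{−x_k})`. -/
theorem wOp_pair (K k : ℕ) (U : Fld 4 ℂ) (h : Fld 4 ℂ → ℂ) :
    wOp (expWeight base₁ (zeroExp + 𝒬P K k)) (flAt (atomP (k + 1))) 0 U h =
      ((1 + wtP K k : ℝ) : ℂ)⁻¹ * (h 0 + (wtP K k : ℂ) * h (atomP (k + 1))) := by
  have hpos : (0 : ℝ) < 1 + wtP K k := by have := wtP_pos K k; linarith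
  have hne : ((1 + wtP K k : ℝ) : ℂ) ≠ 0 := by exact_mod_cast hpos.ne'
  have hint : ∫ z, expWeight base₁ (zeroExp + 𝒬P K k) U z ∂flAt (atomP (k + 1)) = ((1 + wtP K k : ℝ) : ℂ) := by
    rw [integral_flAt, expWeight_P_zero, expWeight_P_atom]; push_cast; ring
  rw [wOp_of_pos (integrable_flAt _ _) (by rw [hint]; exact hne), hint, integral_flAt, expWeight_P_zero, expWeight_P_atom]
  simp only [smul_eq_mul, one_mul]

/-- `hFn` AS AN EQUATION, FOR BOTH FAMILIES: the step `k → k+1` is the dressed operation (shared live exponent, two-atom law) on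
the translates; ONE shift sequence serves both coordinates. [folklore] -/
theorem FnP_succ (K : ℕ) (f : Bool) (k' k : ℕ) (U : Fld 4 ℂ) :
    FnP K f k' (k + 1) U =
      wOp (expWeight base₁ (zeroExp + 𝒬P K k)) (flAt (atomP (k + 1))) 0 U (fun z => FnP K f k' k (U + z)) := by
  have hpos : (0 : ℝ) < 1 + wtP K k := by have := wtP_pos K k; linarith
  have hne : (1 : ℂ) + (wtP K k : ℂ) ≠ 0 := by exact_mod_cast hpos.ne'
  rw [wOp_pair]
  by_cases h : k' = bs K f
  · subst h
    simp only [FnP, ↓reduceIte, shiftP, evB_add, evB_atomP, add_zero, dfP]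
    push_cast
    field_simp
    ring
  · simp [FnP, h]

/-- THE DICTIONARY `hQ` AS AN EQUATION [folklore]: the centred observable-attached exponent IS `c` times the fresh differences of
the live generations `SgP K k b` at the pair `(U+z, U+0)` — for EITHER family's (shared) component. -/
theorem hQP (K : ℕ) (b : (BP K).Birth) (k : ℕ) :
    (fun U z => 𝒬P K k U z - (fun (_ : Fld 4 ℂ) => (0 : ℂ)) U) =
      fun U z => (((1 / 8 : ℝ)) : ℂ) * ∑ x ∈ SgP K k b,
        (FnP K x.1 x.2 k (U + z) - FnP K x.1 x.2 k (U + (fun (_ : (BP K).Birth) (_ : ℕ) => (0 : Fld 4 ℂ)) b k)) := by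
  funext U z; rw [sub_zero]; rfl

/-- `hSg`: every live generation is a live family's birth generation, born, not from the future. [folklore] -/
theorem hSgP (K : ℕ) : ∀ (k : ℕ) (b : (BP K).Birth), ∀ x ∈ SgP K k b,
    x.1 ∈ SP K k b ∧ (BP K).birthScale x.1 ≤ x.2 ∧ x.2 ≤ k := by
  intro k b x hx
  obtain ⟨h1, h2⟩ := mem_SgP.mp hx
  refine ⟨h1, le_of_eq h2.symm, ?_⟩
  rw [h2]; exact (Finset.mem_filter.mp h1).2.1

end Summit.QuantumFields.BalabanUV.T4Continuum.NE1p.DressedTowerWitnessPair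

end
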